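import Literature.Geometry.GaugeTheory.SpincStructureTraceHessian
import Literature.Geometry.GaugeTheory.SelfDualCurvaturePerturbation
import Literature.Geometry.Kaehler.OneFormDerivativeVectorFields
import Literature.Geometry.Lorentzian.GreenIdentity
import Literature.Geometry.Lorentzian.TangentialConnection
import HarnessLib

/-!
# The frame divergence of a 1-form over a `Spin^c` structure is a smooth global function

Topic `Literature/Geometry/GaugeTheory`; the analogue for arbitrary smooth real 1-forms `θ` of
`SpincStructureTraceHessian` (`θ = df`): the frame divergence
`Σ_k (∇_{e_k}θ)(e_k) = Σ_k (e_k(θ(e_k)) - θ(∇_{e_k}e_k))` over the orthonormal frame `e^{(i)}` of a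
chart `U_i` (`= -δθ`) is

* **independent of the chart** on overlaps (`sum_covDerivForm_frame_eq_of_mem_overlap`): with
  `e^{(j)}_k = Σ_l h_{lk} e^{(i)}_l`, the derivatives of the (smooth) change of frames `h` produced by
  `e_k(θ(e_k))` and by `θ(∇_{e_k}e_k)` (Leibniz rule of `∇^{LC}`) cancel, and `h hᵀ = 1`;
* **smooth** on `U_i` (`contMDiffAt_sum_covDerivForm_frame`);

hence the divergence read in the chart chosen at each point is smooth on `X`
(`contMDiff_sum_covDerivForm_frame_indexAt`).  This is the regularity needed to split the
divergence theorem `∫ div θ = 0` (`Symplectic/SymplecticDivergenceIntegral`) into integration-by-parts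
identities.

PROVED, 0 named facts.

## References

* J. W. Morgan, *The Seiberg–Witten Equations and Applications to the Topology of Smooth
  Four-Manifolds* (1996), §3.1–3.2. [MorganSWBook1996]
* F. W. Warner, *Foundations of Differentiable Manifolds and Lie Groups*, GTM 94 (1983), 6.1. [WarnerGTM94]
-/

noncomputable section

open scoped Manifold ContDiff Topology Bundle
open Set Function Filter Bundle
open Literature.Geometry.Lorentzian (PseudoRiemannianMetric)
open Literature.Topology.FourManifolds (SmoothOrientation)

namespace Literature.Geometry.GaugeTheory

namespace SpincStructure

variable {X : Type*} [TopologicalSpace X] [ChartedSpace (EuclideanSpace ℝ (Fin 4)) X] [IsManifold (𝓡 4) ∞ X]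
  {g : PseudoRiemannianMetric (𝓡 4) ∞ (EuclideanSpace ℝ (Fin 4)) (TangentSpace (𝓡 4) : X → Type _)}
  {o : SmoothOrientation (𝓡 4) X} {ι : Type*} (𝔰 : SpincStructure g o ι) [g.HasLeviCivita]

omit [g.HasLeviCivita] in
/-- `y ↦ θ_y(e_l(y))` is differentiable at the points of the chart, for `θ` smooth there. [folklore] -/
theorem mdifferentiableAt_form_frame {θ : RealOneForm X} {x : X} (hθ : θ.SmoothAt x) (i : ι) (l : Fin 4)
    (hx : x ∈ 𝔰.baseSet i) :
    MDifferentiableAt (𝓡 4) 𝓘(ℝ, ℝ) (fun y ↦ θ y (𝔰.frame i l y)) x :=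
  Literature.Geometry.Kaehler.MForm.mdifferentiableAt_apply_vectorField (α := θ.toMForm) hθ.differentiableWithinAt
    (𝔰.mdifferentiableAt_frame i l hx)

/-! ### Chart independence -/

/-- **The frame divergence `Σ_k (e_k(θ(e_k)) - θ(∇_{e_k}e_k))` is chart-independent**: for a real 1-form
`θ` smooth at `x ∈ U_i ∩ U_j` the sums over the frames `e^{(j)}` and `e^{(i)}` agree (the derivatives of
the change of frames cancel between the two terms; `h hᵀ = 1`). [cite: MorganSWBook1996, §3.2] -/
theorem sum_covDerivForm_frame_eq_of_mem_overlap {θ : RealOneForm X} {x : X} (hθ : θ.SmoothAt x)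
    (i j : ι) (hx : x ∈ 𝔰.baseSet i ∩ 𝔰.baseSet j) :
    ∑ k, (mvfderiv (𝓡 4) (fun y ↦ θ y (𝔰.frame j k y)) x (𝔰.frame j k x) - θ x (g.leviCivita (𝔰.frame j k) x (𝔰.frame j k x))) =
      ∑ k, (mvfderiv (𝓡 4) (fun y ↦ θ y (𝔰.frame i k y)) x (𝔰.frame i k x) - θ x (g.leviCivita (𝔰.frame i k) x (𝔰.frame i k x))) := by
  have hcov := g.leviCivita.isCovariantDerivativeOn (s := (univ : Set X))
  set c : Fin 4 → Fin 4 → X → ℝ := fun l k y ↦ 𝔰.frameChange i j y l k with hc_def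
  have hc : ∀ l k, MDifferentiableAt (𝓡 4) 𝓘(ℝ, ℝ) (c l k) x := fun l k ↦ 𝔰.mdifferentiableAt_frameChange i j hx l k
  have hei : ∀ l, MDifferentiableAt (𝓡 4) ((𝓡 4).prod 𝓘(ℝ, EuclideanSpace ℝ (Fin 4)))
      (fun y ↦ TotalSpace.mk' (EuclideanSpace ℝ (Fin 4)) y (𝔰.frame i l y)) x := fun l ↦ 𝔰.mdifferentiableAt_frame i l hx.1
  have hej : ∀ k, MDifferentiableAt (𝓡 4) ((𝓡 4).prod 𝓘(ℝ, EuclideanSpace ℝ (Fin 4)))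
      (fun y ↦ TotalSpace.mk' (EuclideanSpace ℝ (Fin 4)) y (𝔰.frame j k y)) x := fun k ↦ 𝔰.mdifferentiableAt_frame j k hx.2
  have hsm : ∀ l k, MDifferentiableAt (𝓡 4) ((𝓡 4).prod 𝓘(ℝ, EuclideanSpace ℝ (Fin 4)))
      (fun y ↦ TotalSpace.mk' (EuclideanSpace ℝ (Fin 4)) y ((c l k • 𝔰.frame i l) y)) x := fun l k ↦ (hc l k).smul_section (hei l)
  have hsum : ∀ k, MDifferentiableAt (𝓡 4) ((𝓡 4).prod 𝓘(ℝ, EuclideanSpace ℝ (Fin 4)))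
      (fun y ↦ TotalSpace.mk' (EuclideanSpace ℝ (Fin 4)) y (∑ l, (c l k • 𝔰.frame i l) y)) x :=
    fun k ↦ MDifferentiableAt.sum_section (s := Finset.univ) (t := fun l ↦ c l k • 𝔰.frame i l) fun l _ ↦ hsm l k
  -- `e^{(j)}_k = Σ_l c_{lk} e^{(i)}_l` near `x`
  have hexp : ∀ k, ∀ᶠ y in 𝓝 x, 𝔰.frame j k y = ∑ l, (c l k • 𝔰.frame i l) y := fun k ↦ by
    filter_upwards [𝔰.overlap_mem_nhds i j hx] with y hy
    rw [𝔰.frame_eq_sum_frameChange_smul i j hy k]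
    rfl
  -- the connection term
  have hcongr : ∀ k, g.leviCivita (𝔰.frame j k) x = g.leviCivita (fun y ↦ ∑ l, (c l k • 𝔰.frame i l) y) x :=
    fun k ↦ hcov.congr_of_eventuallyEq (hej k) (hsum k) Filter.univ_mem (hexp k)
  have hsumcov : ∀ k, g.leviCivita (fun y ↦ ∑ l, (c l k • 𝔰.frame i l) y) x = ∑ l, g.leviCivita (c l k • 𝔰.frame i l) x :=
    fun k ↦ leviCivita_finset_sum_frame x Finset.univ (fun l ↦ c l k • 𝔰.frame i l) fun l _ ↦ hsm l k
  have hleib : ∀ l k (v : TangentSpace (𝓡 4) x), g.leviCivita (c l k • 𝔰.frame i l) x v =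
      c l k x • g.leviCivita (𝔰.frame i l) x v + (mvfderiv (𝓡 4) (c l k) x v) • 𝔰.frame i l x := by
    intro l k v
    rw [hcov.leibniz (hei l) (hc l k)]
    rfl
  have hconn : ∀ k (v : TangentSpace (𝓡 4) x), θ x (g.leviCivita (𝔰.frame j k) x v) =
      ∑ l, (c l k x * θ x (g.leviCivita (𝔰.frame i l) x v) + mvfderiv (𝓡 4) (c l k) x v * θ x (𝔰.frame i l x)) := by
    intro k v
    rw [hcongr k, hsumcov k]
    simp only [FunLike.coe_sum, Finset.sum_apply, hleib, map_add, map_sum, map_smul, smul_eq_mul]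
  -- the derivative term
  have hθd : ∀ l, MDifferentiableAt (𝓡 4) 𝓘(ℝ, ℝ) (fun y ↦ θ y (𝔰.frame i l y)) x :=
    fun l ↦ 𝔰.mdifferentiableAt_form_frame hθ i l hx.1
  have hexpθ : ∀ k, (fun y ↦ θ y (𝔰.frame j k y)) =ᶠ[𝓝 x] fun y ↦ ∑ l, c l k y * θ y (𝔰.frame i l y) := fun k ↦ by
    filter_upwards [hexp k] with y hy
    rw [hy]
    simp only [Pi.smul_apply', map_sum, map_smul, smul_eq_mul]
  have hderiv : ∀ k (v : TangentSpace (𝓡 4) x), mvfderiv (𝓡 4) (fun y ↦ θ y (𝔰.frame j k y)) x v =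
      ∑ l, (c l k x * mvfderiv (𝓡 4) (fun y ↦ θ y (𝔰.frame i l y)) x v +
        mvfderiv (𝓡 4) (c l k) x v * θ x (𝔰.frame i l x)) := by
    intro k v
    rw [Literature.Geometry.Lorentzian.mvfderiv_congr_nhds (hexpθ k),
      (Literature.Geometry.Lorentzian.mvfderiv_finset_sum (I := 𝓡 4) Finset.univ
        (F := fun l y ↦ c l k y * θ y (𝔰.frame i l y)) (fun l _ ↦ (hc l k).mul (hθd l))).2]
    simp only [FunLike.coe_sum, Finset.sum_apply]
    refine Finset.sum_congr rfl fun l _ ↦ ?_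
    rw [mvfderiv_fun_mul (hc l k) (hθd l)]
    simp only [_root_.add_apply, FunLike.coe_smul, Pi.smul_apply, smul_eq_mul]
    ring
  -- combine: the `dc`-terms cancel
  have hk : ∀ k, mvfderiv (𝓡 4) (fun y ↦ θ y (𝔰.frame j k y)) x (𝔰.frame j k x) -
      θ x (g.leviCivita (𝔰.frame j k) x (𝔰.frame j k x)) =
      ∑ l, ∑ m, c l k x * c m k x * (mvfderiv (𝓡 4) (fun y ↦ θ y (𝔰.frame i l y)) x (𝔰.frame i m x) -
        θ x (g.leviCivita (𝔰.frame i l) x (𝔰.frame i m x))) := by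
    intro k
    rw [hderiv k, hconn k, ← Finset.sum_sub_distrib]
    refine Finset.sum_congr rfl fun l _ ↦ ?_
    have hv : 𝔰.frame j k x = ∑ m, c m k x • 𝔰.frame i m x := 𝔰.frame_eq_sum_frameChange_smul i j hx k
    conv_lhs => rw [hv]
    simp only [map_sum, map_smul, smul_eq_mul, Finset.mul_sum]
    rw [add_sub_add_right_eq_sub, ← Finset.sum_sub_distrib]
    refine Finset.sum_congr rfl fun m _ ↦ ?_
    ring
  have hP := 𝔰.frameChange_mul_transpose_self i j hx
  have hlm : ∀ l m, ∑ k, c l k x * c m k x = if l = m then 1 else 0 := by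
    intro l m
    have := congrFun (congrFun hP l) m
    simpa [Matrix.mul_apply, Matrix.one_apply, hc_def] using this
  calc ∑ k, (mvfderiv (𝓡 4) (fun y ↦ θ y (𝔰.frame j k y)) x (𝔰.frame j k x) - θ x (g.leviCivita (𝔰.frame j k) x (𝔰.frame j k x)))
      = ∑ k, ∑ l, ∑ m, c l k x * c m k x * (mvfderiv (𝓡 4) (fun y ↦ θ y (𝔰.frame i l y)) x (𝔰.frame i m x) -
          θ x (g.leviCivita (𝔰.frame i l) x (𝔰.frame i m x))) := Finset.sum_congr rfl fun k _ ↦ hk k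
    _ = ∑ l, ∑ m, (∑ k, c l k x * c m k x) * (mvfderiv (𝓡 4) (fun y ↦ θ y (𝔰.frame i l y)) x (𝔰.frame i m x) -
          θ x (g.leviCivita (𝔰.frame i l) x (𝔰.frame i m x))) := by
        rw [Finset.sum_comm]
        refine Finset.sum_congr rfl fun l _ ↦ ?_
        rw [Finset.sum_comm]
        refine Finset.sum_congr rfl fun m _ ↦ ?_
        rw [Finset.sum_mul]
    _ = ∑ k, (mvfderiv (𝓡 4) (fun y ↦ θ y (𝔰.frame i k y)) x (𝔰.frame i k x) - θ x (g.leviCivita (𝔰.frame i k) x (𝔰.frame i k x))) := by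
        simp only [hlm, ite_mul, one_mul, zero_mul, Finset.sum_ite_eq, Finset.mem_univ, if_true]

/-! ### Smoothness -/

omit [g.HasLeviCivita] in
/-- `y ↦ θ_y(W_y)` is smooth at `x` for a form and a field smooth at `x`. [folklore] -/
theorem contMDiffAt_form_apply_field {θ : RealOneForm X} {x : X} (hθ : θ.SmoothAt x)
    {W : Π y : X, TangentSpace (𝓡 4) y}
    (hW : ContMDiffAt (𝓡 4) ((𝓡 4).prod 𝓘(ℝ, EuclideanSpace ℝ (Fin 4))) ∞
      (fun y : X ↦ TotalSpace.mk' (EuclideanSpace ℝ (Fin 4)) (E := (TangentSpace (𝓡 4) : X → Type _)) y (W y)) x) :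
    ContMDiffAt (𝓡 4) 𝓘(ℝ, ℝ) ∞ (fun y ↦ θ y (W y)) x := by
  have h := smoothAt_apply_sections (α := θ.toMForm) hθ (V := ![W]) (fun j ↦ by fin_cases j; exact hW)
  refine h.congr_of_eventuallyEq (Eventually.of_forall fun y ↦ ?_)
  simp [RealOneForm.toMForm_apply]

/-- **The frame divergence is smooth at the points of `U_i`**, for `θ` smooth on `X`
(`e_k(θ(e_k))` is the derivative of a smooth function along a smooth field; `∇_{e_k}e_k` is a smooth
field). [cite: MorganSWBook1996, §3.2] -/
theorem contMDiffAt_sum_covDerivForm_frame {θ : RealOneForm X} (hθ : ∀ y, θ.SmoothAt y) (i : ι) {x : X}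
    (hx : x ∈ 𝔰.baseSet i) :
    ContMDiffAt (𝓡 4) 𝓘(ℝ, ℝ) ∞ (fun y ↦ ∑ k, (mvfderiv (𝓡 4) (fun z ↦ θ z (𝔰.frame i k z)) y (𝔰.frame i k y) -
      θ y (g.leviCivita (𝔰.frame i k) y (𝔰.frame i k y)))) x := by
  refine ContMDiffAt.sum fun k _ ↦ ?_
  have hu : ∀ y ∈ 𝔰.baseSet i, ContMDiffAt (𝓡 4) 𝓘(ℝ, ℝ) ∞ (fun z ↦ θ z (𝔰.frame i k z)) y := fun y hy ↦
    contMDiffAt_form_apply_field (hθ y) (𝔰.contMDiffAt_frame i k hy)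
  have hu' : ContMDiffAt (𝓡 4) 𝓘(ℝ, ℝ) (∞ + 1) (fun z ↦ θ z (𝔰.frame i k z)) x := by simpa using hu x hx
  have h1 : ContMDiffAt (𝓡 4) 𝓘(ℝ, ℝ) ∞
      (fun y ↦ mvfderiv (𝓡 4) (fun z ↦ θ z (𝔰.frame i k z)) y (𝔰.frame i k y)) x :=
    Literature.Geometry.Lorentzian.contMDiffAt_mvfderiv_apply_of_le hu' (𝔰.contMDiffAt_frame i k hx)
  have h2 : ContMDiffAt (𝓡 4) 𝓘(ℝ, ℝ) ∞ (fun y ↦ θ y (g.leviCivita (𝔰.frame i k) y (𝔰.frame i k y))) x :=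
    contMDiffAt_form_apply_field (hθ x) (𝔰.contMDiffAt_leviCivita_frame_apply i k hx (𝔰.contMDiffAt_frame i k hx))
  exact h1.sub h2

/-- **`x ↦ Σ_k (∇_{e_k}θ)(e_k)(x)` (the chart read at each point) is a smooth function on `X`** for a
smooth real 1-form `θ`. [cite: WarnerGTM94, 6.1] -/
theorem contMDiff_sum_covDerivForm_frame_indexAt {θ : RealOneForm X} (hθ : ∀ y, θ.SmoothAt y) :
    ContMDiff (𝓡 4) 𝓘(ℝ, ℝ) ∞ fun x ↦ ∑ k, (mvfderiv (𝓡 4) (fun z ↦ θ z (𝔰.frame (𝔰.indexAt x) k z)) x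
      (𝔰.frame (𝔰.indexAt x) k x) - θ x (g.leviCivita (𝔰.frame (𝔰.indexAt x) k) x (𝔰.frame (𝔰.indexAt x) k x))) := by
  intro x
  have hi := 𝔰.mem_baseSet_indexAt x
  refine (𝔰.contMDiffAt_sum_covDerivForm_frame hθ (𝔰.indexAt x) hi).congr_of_eventuallyEq ?_
  filter_upwards [(𝔰.isOpen_baseSet (𝔰.indexAt x)).mem_nhds hi] with y hy
  exact 𝔰.sum_covDerivForm_frame_eq_of_mem_overlap (hθ y) (𝔰.indexAt x) (𝔰.indexAt y) ⟨hy, 𝔰.mem_baseSet_indexAt y⟩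

end SpincStructure

end Literature.Geometry.GaugeTheory

end
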